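import Summits.Parity.GeneralizedHardyLittlewood.Theorems.BeyondDiagonalBeatsQuarter.KernelFormXSqBridge
import Mathlib.Data.Nat.Factorization.Induction
import Mathlib.RingTheory.PowerSeries.Exp
import HarnessLib

/-!
# Route `PrimeLevelFamEdge`, crux K_A `MomentsBeyondDiagonal` (stmt-Parity-20007), line «petersson_layers» v4, stub `stub_diag`:
# **the exponential power-series weights `e^{X log d}` and the Rademacher identities
# `Σ_{de = k}(log d − log e)^r = τ(k)·(1, 0, P₂, 0, 3P₂² − 2P₄)(k)` on squarefree `k`** (brick D3a of «D4TAIL»)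

Tools of the `t`-deformation route to «D4TAIL» (`…DiagRemMoebiusLogPow`, module docstring). The deformation parameter is the
variable `X` of `ℝ⟦X⟧`; the weight `d ↦ e^{X log d} = rescale (log d) exp` is completely multiplicative (`e^{X log d}e^{X log e} =
e^{X log(de)}`, Mathlib's `PowerSeries.exp_mul_exp_eq_exp_add`), so binomial bookkeeping of the log-decorations becomes ring algebra
in `ArithmeticFunction ℝ⟦X⟧`, and `X`-coefficients are read off by `coeff_rescale_exp`. With `S(k) = Σ_{de=k} e^{X(log d − log e)}`
(multiplicative), the `X⁴`-coefficient on squarefree `k` is the fourth Rademacher moment `τ(k)·D₄(k)/4!`, `D₄ = 3P₂² − 2P₄`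
(`P_j(k) = Σ_{p∣k} logʲp`) — the decoration of «D4TAIL».

* `coeff_rescale_exp` — `[Xⁱ] e^{aX} = aⁱ/i!`;
* `isMultiplicative_expWeight` — `d ↦ e^{±X log d}` (`0 ↦ 0`) is a multiplicative arithmetic function (hypothesis-parametrised, def-free);
* `coeff_mul_four` — `[X⁴](φψ)` as the five products of coefficients;
* `sum_divisorsAntidiagonal_log_sub_pow_of_squarefree` — **for squarefree `k`: `Σ_{(d,e), de=k}(log d − log e)^r =
  τ(k), 0, τ(k)P₂(k), 0, τ(k)(3P₂(k)² − 2P₄(k))` for `r = 0,1,2,3,4`**;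
* `copTauW_mul_decorFour_eq` — hence `a_n(k)·D₄(k) = W_n(k)·Σ_{de=k}(log d − log e)⁴` for EVERY `k` (`a_n = copTauW n = 1_{(k,n)=1}τW`,
  `W_n = 1_{(k,n)=1}W`; both sides vanish off the squarefree numbers), and the `P₂` analogue `copTauW_mul_primeSq_eq`.

Def-free; theorems only; elementary. Helper `--supports stmt-Parity-20007`; closes nothing; K_A, K_B and the Parity summit are NOT
proved; nothing about Landau–Siegel zeros.

## References
* E. Kowalski, P. Michel, J. VanderKam, J. reine angew. Math. 526 (2000), Prop. 5.1 p. 18.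
  [cite: KowalskiMichelVanderKam2000, Prop. 5.1 — derivation (decorated Selberg coefficients)]
-/

noncomputable section

open Finset Real ArithmeticFunction

namespace Summit.Parity.GeneralizedHardyLittlewood.Theorems.MomentsBeyondDiagonal.DiagCorner

open Literature.NumberTheory.LFunctions.KMV2000.MollifierMainTerm (W)
open Summit.Parity.GeneralizedHardyLittlewood.Theorems.BeyondDiagonalBeatsQuarter.KernelFormXSq
  (copTauW copTauW_apply W_eq_zero_of_not_squarefree)

/-! ### Power-series tools -/

/-- `[Xⁱ] e^{aX} = aⁱ/i!`. [folklore] -/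
theorem coeff_rescale_exp (a : ℝ) (i : ℕ) :
    PowerSeries.coeff i (PowerSeries.rescale a (PowerSeries.exp ℝ)) = a ^ i / (i.factorial : ℝ) := by
  rw [PowerSeries.coeff_rescale, PowerSeries.coeff_exp]
  simp [div_eq_mul_inv]

/-- `[X⁴](φψ) = Σ_{i ≤ 4} [Xⁱ]φ·[X^{4−i}]ψ`, written out. [folklore] -/
theorem coeff_mul_four (φ ψ : PowerSeries ℝ) :
    PowerSeries.coeff 4 (φ * ψ) =
      PowerSeries.coeff 0 φ * PowerSeries.coeff 4 ψ + PowerSeries.coeff 1 φ * PowerSeries.coeff 3 ψ +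
        PowerSeries.coeff 2 φ * PowerSeries.coeff 2 ψ + PowerSeries.coeff 3 φ * PowerSeries.coeff 1 ψ +
          PowerSeries.coeff 4 φ * PowerSeries.coeff 0 ψ := by
  rw [PowerSeries.coeff_mul, Finset.Nat.sum_antidiagonal_eq_sum_range_succ
    (fun i j ↦ PowerSeries.coeff i φ * PowerSeries.coeff j ψ)]
  simp only [Finset.sum_range_succ, Finset.sum_range_zero, zero_add]

/-- `[X²](φψ)` written out. [folklore] -/
theorem coeff_mul_two (φ ψ : PowerSeries ℝ) :
    PowerSeries.coeff 2 (φ * ψ) =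
      PowerSeries.coeff 0 φ * PowerSeries.coeff 2 ψ + PowerSeries.coeff 1 φ * PowerSeries.coeff 1 ψ +
        PowerSeries.coeff 2 φ * PowerSeries.coeff 0 ψ := by
  rw [PowerSeries.coeff_mul, Finset.Nat.sum_antidiagonal_eq_sum_range_succ
    (fun i j ↦ PowerSeries.coeff i φ * PowerSeries.coeff j ψ)]
  simp only [Finset.sum_range_succ, Finset.sum_range_zero, zero_add]

/-- `[X¹](φψ)`, `[X³](φψ)`, `[X⁰](φψ)` written out. [folklore] -/
theorem coeff_mul_odd (φ ψ : PowerSeries ℝ) :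
    PowerSeries.coeff 0 (φ * ψ) = PowerSeries.coeff 0 φ * PowerSeries.coeff 0 ψ ∧
    PowerSeries.coeff 1 (φ * ψ) = PowerSeries.coeff 0 φ * PowerSeries.coeff 1 ψ + PowerSeries.coeff 1 φ * PowerSeries.coeff 0 ψ ∧
    PowerSeries.coeff 3 (φ * ψ) =
      PowerSeries.coeff 0 φ * PowerSeries.coeff 3 ψ + PowerSeries.coeff 1 φ * PowerSeries.coeff 2 ψ +
        PowerSeries.coeff 2 φ * PowerSeries.coeff 1 ψ + PowerSeries.coeff 3 φ * PowerSeries.coeff 0 ψ := by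
  refine ⟨?_, ?_, ?_⟩ <;>
  · rw [PowerSeries.coeff_mul, Finset.Nat.sum_antidiagonal_eq_sum_range_succ
      (fun i j ↦ PowerSeries.coeff i φ * PowerSeries.coeff j ψ)]
    simp only [Finset.sum_range_succ, Finset.sum_range_zero, zero_add]

/-- **The exponential weight is multiplicative**: if `E(0) = 0` and `E(d) = e^{s·X·log d}` for `d ≥ 1` (`s` a fixed real sign/scale),
then `E` is a multiplicative arithmetic function (in fact completely multiplicative on `d ≥ 1`). [folklore] -/
theorem isMultiplicative_expWeight (s : ℝ) (E : ArithmeticFunction (PowerSeries ℝ))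
    (hE : ∀ d : ℕ, d ≠ 0 → E d = PowerSeries.rescale (s * Real.log d) (PowerSeries.exp ℝ)) :
    E.IsMultiplicative := by
  refine ⟨?_, fun {m n} _ ↦ ?_⟩
  · rw [hE 1 one_ne_zero]; simp
  · rcases Nat.eq_zero_or_pos m with rfl | hm
    · simp
    rcases Nat.eq_zero_or_pos n with rfl | hn
    · simp
    rw [hE m (by omega), hE n (by omega), hE (m * n) (Nat.mul_ne_zero (by omega) (by omega)),
      PowerSeries.exp_mul_exp_eq_exp_add]
    congr 1
    push_cast
    rw [Real.log_mul (by exact_mod_cast (by omega : m ≠ 0)) (by exact_mod_cast (by omega : n ≠ 0))]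
    ring

/-- Products of exponential weights at `d, e ≥ 1`: `e^{sX log d}·e^{tX log e} = e^{X(s log d + t log e)}`. [folklore] -/
theorem expWeight_mul (s t : ℝ) (d e : ℕ) :
    PowerSeries.rescale (s * Real.log d) (PowerSeries.exp ℝ) * PowerSeries.rescale (t * Real.log e) (PowerSeries.exp ℝ) =
      PowerSeries.rescale (s * Real.log d + t * Real.log e) (PowerSeries.exp ℝ) :=
  PowerSeries.exp_mul_exp_eq_exp_add _ _

/-! ### The symmetric kernel `S(k) = Σ_{de=k} e^{X(log d − log e)}` and its low coefficients on squarefree `k` -/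

/-- The coefficients of `S(k) = Σ_{de = k} e^{X log d}e^{−X log e}`: `[Xʳ]S(k) = Σ_{de=k}(log d − log e)^r / r!`. [folklore] -/
theorem coeff_symmKernel (E Em : ArithmeticFunction (PowerSeries ℝ))
    (hE : ∀ d : ℕ, d ≠ 0 → E d = PowerSeries.rescale (1 * Real.log d) (PowerSeries.exp ℝ))
    (hEm : ∀ d : ℕ, d ≠ 0 → Em d = PowerSeries.rescale (-1 * Real.log d) (PowerSeries.exp ℝ)) (k r : ℕ) :
    PowerSeries.coeff r ((E * Em) k) =
      ∑ x ∈ k.divisorsAntidiagonal, (Real.log x.1 - Real.log x.2) ^ r / (r.factorial : ℝ) := by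
  rw [mul_apply, map_sum]
  refine Finset.sum_congr rfl fun x hx ↦ ?_
  have hx' := Nat.mem_divisorsAntidiagonal.1 hx
  have h1 : x.1 ≠ 0 := fun h ↦ hx'.2 (by rw [← hx'.1, h, zero_mul])
  have h2 : x.2 ≠ 0 := fun h ↦ hx'.2 (by rw [← hx'.1, h, mul_zero])
  rw [hE x.1 h1, hEm x.2 h2, expWeight_mul, coeff_rescale_exp]
  congr 1; ring

set_option maxHeartbeats 1600000 in
/-- **The Rademacher identities on squarefree numbers**: `Σ_{(d,e), de=k}(log d − log e)^r` equals `τ(k)` (`r=0`), `0` (`r=1`),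
`τ(k)P₂(k)` (`r=2`), `0` (`r=3`), `τ(k)(3P₂(k)² − 2P₄(k))` (`r=4`), where `P_j(k) = Σ_{p∣k} logʲp` — i.e. `τ(k)·𝔼[(Σ_{p∣k} ε_p log p)^r]`
for independent signs `ε_p`. [folklore] -/
theorem sum_divisorsAntidiagonal_log_sub_pow_of_squarefree (k : ℕ) (hk : Squarefree k) :
    (∑ x ∈ k.divisorsAntidiagonal, (Real.log x.1 - Real.log x.2) ^ 0) = (k.divisors.card : ℝ) ∧
    (∑ x ∈ k.divisorsAntidiagonal, (Real.log x.1 - Real.log x.2) ^ 1) = 0 ∧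
    (∑ x ∈ k.divisorsAntidiagonal, (Real.log x.1 - Real.log x.2) ^ 2) =
      (k.divisors.card : ℝ) * ∑ p ∈ k.primeFactors, Real.log p ^ 2 ∧
    (∑ x ∈ k.divisorsAntidiagonal, (Real.log x.1 - Real.log x.2) ^ 3) = 0 ∧
    (∑ x ∈ k.divisorsAntidiagonal, (Real.log x.1 - Real.log x.2) ^ 4) =
      (k.divisors.card : ℝ) * (3 * (∑ p ∈ k.primeFactors, Real.log p ^ 2) ^ 2 - 2 * ∑ p ∈ k.primeFactors, Real.log p ^ 4) := by
  classical
  -- the exponential weights and the symmetric kernel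
  set E : ArithmeticFunction (PowerSeries ℝ) :=
    ⟨fun d ↦ if d = 0 then 0 else PowerSeries.rescale (1 * Real.log d) (PowerSeries.exp ℝ), if_pos rfl⟩ with hEdef
  set Em : ArithmeticFunction (PowerSeries ℝ) :=
    ⟨fun d ↦ if d = 0 then 0 else PowerSeries.rescale (-1 * Real.log d) (PowerSeries.exp ℝ), if_pos rfl⟩ with hEmdef
  have hE : ∀ d : ℕ, d ≠ 0 → E d = PowerSeries.rescale (1 * Real.log d) (PowerSeries.exp ℝ) := fun d hd ↦ by
    rw [hEdef]; exact if_neg hd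
  have hEm : ∀ d : ℕ, d ≠ 0 → Em d = PowerSeries.rescale (-1 * Real.log d) (PowerSeries.exp ℝ) := fun d hd ↦ by
    rw [hEmdef]; exact if_neg hd
  have hS : (E * Em).IsMultiplicative := (isMultiplicative_expWeight 1 E hE).mul (isMultiplicative_expWeight (-1) Em hEm)
  -- `T r k := Σ_{de=k}(log d − log e)^r = r! · [Xʳ] S(k)`
  have hT : ∀ k r : ℕ, ∑ x ∈ k.divisorsAntidiagonal, (Real.log x.1 - Real.log x.2) ^ r =
      (r.factorial : ℝ) * PowerSeries.coeff r ((E * Em) k) := by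
    intro k r
    rw [coeff_symmKernel E Em hE hEm k r, Finset.mul_sum]
    refine Finset.sum_congr rfl fun x _ ↦ ?_
    have : (r.factorial : ℝ) ≠ 0 := by positivity
    field_simp
  -- coefficients `c r k := [Xʳ] S(k)`; the claim in coefficient form
  have hTc : ∀ k r : ℕ, ∑ x ∈ k.divisorsAntidiagonal, (Real.log x.1 - Real.log x.2) ^ r =
      (r.factorial : ℝ) * PowerSeries.coeff r ((E * Em) k) := hT
  -- values at a prime
  have hprime : ∀ p : ℕ, p.Prime → ∀ r : ℕ, PowerSeries.coeff r ((E * Em) p) =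
      ((Real.log p) ^ r + (-Real.log p) ^ r) / (r.factorial : ℝ) := by
    intro p hp r
    rw [coeff_symmKernel E Em hE hEm p r, Nat.sum_divisorsAntidiagonal (fun d e ↦ (Real.log d - Real.log e) ^ r / (r.factorial : ℝ)),
      Nat.Prime.divisors hp, Finset.sum_pair hp.one_lt.ne, Nat.div_one, Nat.div_self hp.pos]
    simp only [Nat.cast_one, Real.log_one, zero_sub, sub_zero]
    ring
  suffices H : Squarefree k →
      PowerSeries.coeff 0 ((E * Em) k) = (k.divisors.card : ℝ) ∧
      PowerSeries.coeff 1 ((E * Em) k) = 0 ∧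
      PowerSeries.coeff 2 ((E * Em) k) = (k.divisors.card : ℝ) * (∑ p ∈ k.primeFactors, Real.log p ^ 2) / 2 ∧
      PowerSeries.coeff 3 ((E * Em) k) = 0 ∧
      PowerSeries.coeff 4 ((E * Em) k) =
        (k.divisors.card : ℝ) * (3 * (∑ p ∈ k.primeFactors, Real.log p ^ 2) ^ 2 - 2 * ∑ p ∈ k.primeFactors, Real.log p ^ 4) / 24 by
    obtain ⟨h0, h1, h2, h3, h4⟩ := H hk
    refine ⟨?_, ?_, ?_, ?_, ?_⟩
    · rw [hTc, h0]; simp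
    · rw [hTc, h1]; simp
    · rw [hTc, h2]; simp [Nat.factorial]; ring
    · rw [hTc, h3]; simp
    · rw [hTc, h4]; simp [Nat.factorial]; ring
  -- induction over the prime factorisation
  clear hk
  induction k using induction_on_primes with
  | zero => intro h0; exact absurd h0 not_squarefree_zero
  | one =>
    intro _
    have h1 : ∀ r : ℕ, PowerSeries.coeff r ((E * Em) 1) = (0 : ℝ) ^ r / (r.factorial : ℝ) := by
      intro r
      rw [coeff_symmKernel E Em hE hEm 1 r, Nat.divisorsAntidiagonal_one, Finset.sum_singleton]
      simp
    rw [h1 0, h1 1, h1 2, h1 3, h1 4, Nat.divisors_one, Nat.primeFactors_one]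
    norm_num
  | prime_mul p a hp ih =>
    intro hsq
    have ha : Squarefree a := hsq.of_mul_right
    have hcop : Nat.Coprime p a := Nat.coprime_of_squarefree_mul hsq
    have hpa : ¬ p ∣ a := fun hdvd ↦ hp.ne_one (Nat.Coprime.eq_one_of_dvd hcop hdvd)
    have ha0 : a ≠ 0 := ha.ne_zero
    obtain ⟨i0, i1, i2, i3, i4⟩ := ih ha
    have hmul : (E * Em) (p * a) = (E * Em) p * (E * Em) a := hS.map_mul_of_coprime hcop
    -- bookkeeping of `τ`, `P₂`, `P₄` for the coprime product
    have hτ : ((p * a).divisors.card : ℝ) = 2 * (a.divisors.card : ℝ) := by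
      rw [Nat.Coprime.card_divisors_mul hcop, Nat.Prime.divisors hp, Finset.card_pair hp.one_lt.ne]
      push_cast; ring
    have hpf : (p * a).primeFactors = insert p a.primeFactors := by
      rw [Nat.primeFactors_mul hp.ne_zero ha0, Nat.Prime.primeFactors hp]; rfl
    have hpmem : p ∉ a.primeFactors := fun h ↦ hpa (Nat.dvd_of_mem_primeFactors h)
    have hP2 : ∑ q ∈ (p * a).primeFactors, Real.log q ^ 2 = Real.log p ^ 2 + ∑ q ∈ a.primeFactors, Real.log q ^ 2 := by
      rw [hpf, Finset.sum_insert hpmem]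
    have hP4 : ∑ q ∈ (p * a).primeFactors, Real.log q ^ 4 = Real.log p ^ 4 + ∑ q ∈ a.primeFactors, Real.log q ^ 4 := by
      rw [hpf, Finset.sum_insert hpmem]
    have q0 := hprime p hp 0
    have q1 := hprime p hp 1
    have q2 := hprime p hp 2
    have q3 := hprime p hp 3
    have q4 := hprime p hp 4
    simp only [pow_zero, Nat.factorial_zero, Nat.cast_one, div_one, pow_one, add_neg_cancel, zero_div] at q0 q1
    obtain ⟨m0, m1, m3⟩ := coeff_mul_odd ((E * Em) p) ((E * Em) a)
    refine ⟨?_, ?_, ?_, ?_, ?_⟩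
    · rw [hmul, m0, q0, i0, hτ]; norm_num
    · rw [hmul, m1, q0, q1, i0, i1]; ring
    · rw [hmul, coeff_mul_two, q0, q1, q2, i0, i1, i2, hτ, hP2]
      simp [Nat.factorial]; ring
    · rw [hmul, m3, q0, q1, q2, q3, i0, i1, i2, i3]
      ring
    · rw [hmul, coeff_mul_four, q0, q1, q2, q3, q4, i0, i1, i2, i3, i4, hτ, hP2, hP4]
      simp [Nat.factorial]; ring

/-- **`a_n(k)·D₄(k) = W_n(k)·Σ_{de=k}(log d − log e)⁴` for every `k`** (`a_n = copTauW n`, `W_n(k) = 1_{(k,n)=1}W(k)`,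
`D₄ = 3P₂² − 2P₄`): on squarefree `k` this is the fourth Rademacher identity, elsewhere both sides vanish (`W(k) = 0`).
[cite: KowalskiMichelVanderKam2000, Prop. 5.1 — derivation (decorated Selberg coefficients)] -/
theorem copTauW_mul_decorFour_eq (n k : ℕ) :
    copTauW n k * (3 * (∑ p ∈ k.primeFactors, Real.log p ^ 2) ^ 2 - 2 * ∑ p ∈ k.primeFactors, Real.log p ^ 4) =
      (if k.Coprime n then W k else 0) * ∑ x ∈ k.divisorsAntidiagonal, (Real.log x.1 - Real.log x.2) ^ 4 := by
  by_cases hk : Squarefree k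
  · rw [copTauW_apply, (sum_divisorsAntidiagonal_log_sub_pow_of_squarefree k hk).2.2.2.2]
    split_ifs <;> ring
  · rw [copTauW_apply, W_eq_zero_of_not_squarefree hk]
    split_ifs <;> simp

/-- The `P₂` analogue: `a_n(k)·P₂(k) = W_n(k)·Σ_{de=k}(log d − log e)²` for every `k`.
[cite: KowalskiMichelVanderKam2000, Prop. 5.1 — derivation (decorated Selberg coefficients)] -/
theorem copTauW_mul_primeSq_eq (n k : ℕ) :
    copTauW n k * (∑ p ∈ k.primeFactors, Real.log p ^ 2) =
      (if k.Coprime n then W k else 0) * ∑ x ∈ k.divisorsAntidiagonal, (Real.log x.1 - Real.log x.2) ^ 2 := by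
  by_cases hk : Squarefree k
  · rw [copTauW_apply, (sum_divisorsAntidiagonal_log_sub_pow_of_squarefree k hk).2.2.1]
    split_ifs <;> ring
  · rw [copTauW_apply, W_eq_zero_of_not_squarefree hk]
    split_ifs <;> simp

/-- And the undecorated one: `a_n(k) = W_n(k)·Σ_{de=k}(log d − log e)⁰` (`= W_n(k)τ(k)`) for every `k`. [folklore] -/
theorem copTauW_eq_mul_sum_pow_zero (n k : ℕ) :
    copTauW n k = (if k.Coprime n then W k else 0) * ∑ x ∈ k.divisorsAntidiagonal, (Real.log x.1 - Real.log x.2) ^ 0 := by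
  by_cases hk : Squarefree k
  · rw [copTauW_apply, (sum_divisorsAntidiagonal_log_sub_pow_of_squarefree k hk).1]
    split_ifs <;> ring
  · rw [copTauW_apply, W_eq_zero_of_not_squarefree hk]
    split_ifs <;> simp

end Summit.Parity.GeneralizedHardyLittlewood.Theorems.MomentsBeyondDiagonal.DiagCorner

end
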